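import Summits.MatrixMultiplication.OmegaCensus.DicyclicSubFourP3Structure
import HarnessLib

/-!
# Shifted disjointness and exact tilings in dicyclic type; three-term character sums

ω-census, family (b3).  Framing: lottery ticket; floor = certified bounds/negative ranges.

Dihedral-like `G(A,c₀)`.  Besides the six disjointness relations of `DihedralLikeTPPBound.lean` (the two vertex
triangles), the TPP also forbids the `c₀`-SHIFTED coincidences between the same pairs of boxes (pair the quotients the
other way round: `ρa'(τa)⁻¹` instead of `τa(ρa')⁻¹`); for `c₀ = 0` these are the same relations, in dicyclic type
they are new:

* `disjoint_sumset₁_shift'`, `disjoint_sumset₂_shift'`, `disjoint_sumset₃_shift'`.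
* `periodic_of_exact_vertex`: consequently, if the three boxes of a vertex triangle tile `A` EXACTLY, each of them is
  `c₀`-periodic (its `c₀`-translate misses the other two boxes).
* `three_term_charsum_ne_zero`: if `3 ∤ |A|`, no character sum over three elements vanishes (a vanishing sum of three
  unit complex numbers needs a primitive cube root of unity among their ratios).

These are the tools for `C2Quaternion40Law.lean` (`β(C₂ × Q₄₀) = 96`).
-/

namespace Summit.MatrixMultiplication.OmegaCensus

open Literature.Combinatorics.Additive Finset

section Shifted

variable {A : Type*} {G : Type*} {ρ τ : A → G} {c₀ : A} [AddCommGroup A] [DecidableEq A] [Group G]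
  {S T U : Finset G}

/-- **Shifted disjointness 1**: `S₁+T₀+U_k` misses `(S₀+T₁+U_k) + c₀` (the relation
`ρa'(τa)⁻¹ · ρb(τb')⁻¹ · (u u'⁻¹) = 1` would force `ρ a' = τ a`). [folklore] -/
theorem disjoint_sumset₁_shift' (hρρ : ∀ a b, ρ a * ρ b = ρ (a + b)) (hρτ : ∀ a b, ρ a * τ b = τ (b - a))
    (hττ : ∀ a b, τ a * τ b = ρ (c₀ + b - a)) (hne : ∀ a b, ρ a ≠ τ b)
    (h : TripleProductProperty S T U) (k : Bool) {X Y Z X' Y' : Finset A}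
    (hX : ∀ a ∈ X, τ a ∈ S) (hY : ∀ b ∈ Y, ρ b ∈ T) (hZ : ∀ c ∈ Z, cond k (τ c) (ρ c) ∈ U)
    (hX' : ∀ a ∈ X', ρ a ∈ S) (hY' : ∀ b ∈ Y', τ b ∈ T) :
    Disjoint ((X ×ˢ Y ×ˢ Z).image fun p : A × A × A => p.1 + p.2.1 + p.2.2)
      (((X' ×ˢ Y' ×ˢ Z).image fun p : A × A × A => p.1 + p.2.1 + p.2.2).image (· + c₀)) := by
  rw [disjoint_left]
  intro x hx hx'
  rw [mem_sumset₃] at hx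
  obtain ⟨a, ha, b, hb, c, hc, rfl⟩ := hx
  obtain ⟨x', hx', heq⟩ := mem_image.1 hx'
  rw [mem_sumset₃] at hx'
  obtain ⟨a', ha', b', hb', c', hc', rfl⟩ := hx'
  have key : ρ a' * (τ a)⁻¹ * (ρ b * (τ b')⁻¹) * (cond k (τ c) (ρ c') * (cond k (τ c') (ρ c))⁻¹) = 1 := by
    rw [cond_mul_cond_inv' hρρ hττ, inv_tau hρρ hττ, inv_tau hρρ hττ, hρτ, hρτ, hττ, hρρ, ← rho_zero hρρ]
    congr 1
    have e : a' + b' + c' + c₀ = a + b + c := heq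
    linear_combination (norm := abel1) e
  obtain ⟨h1, -, -⟩ := h _ (hX' a' ha') _ (hX a ha) _ (hY b hb) _ (hY' b' hb')
    _ (cond_mem_fst' (hZ c' hc') (hZ c hc)) _ (cond_mem_snd' (hZ c' hc') (hZ c hc)) key
  exact hne _ _ h1

/-- **Shifted disjointness 2**: `(S_i+T₀+U₁) + c₀` misses `S_i+T₁+U₀` (the relation would force `ρ b' = τ b`).
[folklore] -/
theorem disjoint_sumset₂_shift' (hρρ : ∀ a b, ρ a * ρ b = ρ (a + b)) (hρτ : ∀ a b, ρ a * τ b = τ (b - a))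
    (hττ : ∀ a b, τ a * τ b = ρ (c₀ + b - a)) (hne : ∀ a b, ρ a ≠ τ b)
    (h : TripleProductProperty S T U) (i : Bool) {X Y Z X' Y' Z' : Finset A}
    (hX : ∀ a ∈ X, cond i (τ a) (ρ a) ∈ S) (hY : ∀ b ∈ Y, ρ b ∈ T) (hZ : ∀ c ∈ Z, τ c ∈ U)
    (hX' : ∀ a ∈ X', cond i (τ a) (ρ a) ∈ S) (hY' : ∀ b ∈ Y', τ b ∈ T) (hZ' : ∀ c ∈ Z', ρ c ∈ U) :
    Disjoint (((X ×ˢ Y ×ˢ Z).image fun p : A × A × A => p.1 + p.2.1 + p.2.2).image (· + c₀))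
      ((X' ×ˢ Y' ×ˢ Z').image fun p : A × A × A => p.1 + p.2.1 + p.2.2) := by
  rw [disjoint_left]
  intro x hx hx'
  obtain ⟨x₀, hx₀, heq⟩ := mem_image.1 hx
  rw [mem_sumset₃] at hx₀ hx'
  obtain ⟨a', ha', b', hb', c', hc', rfl⟩ := hx₀
  obtain ⟨a, ha, b, hb, c, hc, rfl⟩ := hx'
  have key : cond i (τ a) (ρ a') * (cond i (τ a') (ρ a))⁻¹ * (ρ b' * (τ b)⁻¹) * (ρ c * (τ c')⁻¹) = 1 := by
    rw [cond_mul_cond_inv' hρρ hττ, inv_tau hρρ hττ, inv_tau hρρ hττ, hρτ, hρτ, hρτ, hττ, ← rho_zero hρρ]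
    congr 1
    have e : a' + b' + c' + c₀ = a + b + c := heq
    linear_combination (norm := abel1) e
  obtain ⟨-, h2, -⟩ := h _ (cond_mem_fst' (hX a' ha') (hX' a ha)) _ (cond_mem_snd' (hX a' ha') (hX' a ha))
    _ (hY b' hb') _ (hY' b hb) _ (hZ' c hc) _ (hZ c' hc') key
  exact hne _ _ h2

/-- **Shifted disjointness 3**: `S₁+T_j+U₀` misses `(S₀+T_j+U₁) + c₀` (the relation would force `ρ a' = τ a`).
[folklore] -/
theorem disjoint_sumset₃_shift' (hρρ : ∀ a b, ρ a * ρ b = ρ (a + b)) (hρτ : ∀ a b, ρ a * τ b = τ (b - a))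
    (hτρ : ∀ a b, τ a * ρ b = τ (a + b)) (hττ : ∀ a b, τ a * τ b = ρ (c₀ + b - a)) (hne : ∀ a b, ρ a ≠ τ b)
    (h : TripleProductProperty S T U) (j : Bool) {X Y Z X' Z' : Finset A}
    (hX : ∀ a ∈ X, τ a ∈ S) (hY : ∀ b ∈ Y, cond j (τ b) (ρ b) ∈ T) (hZ : ∀ c ∈ Z, ρ c ∈ U)
    (hX' : ∀ a ∈ X', ρ a ∈ S) (hZ' : ∀ c ∈ Z', τ c ∈ U) :
    Disjoint ((X ×ˢ Y ×ˢ Z).image fun p : A × A × A => p.1 + p.2.1 + p.2.2)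
      (((X' ×ˢ Y ×ˢ Z').image fun p : A × A × A => p.1 + p.2.1 + p.2.2).image (· + c₀)) := by
  rw [disjoint_left]
  intro x hx hx'
  rw [mem_sumset₃] at hx
  obtain ⟨a, ha, b, hb, c, hc, rfl⟩ := hx
  obtain ⟨x', hx', heq⟩ := mem_image.1 hx'
  rw [mem_sumset₃] at hx'
  obtain ⟨a', ha', b', hb', c', hc', rfl⟩ := hx'
  have key : ρ a' * (τ a)⁻¹ * (cond j (τ b') (ρ b) * (cond j (τ b) (ρ b'))⁻¹) * (ρ c * (τ c')⁻¹) = 1 := by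
    rw [cond_mul_cond_inv' hρρ hττ, inv_tau hρρ hττ, inv_tau hρρ hττ, hρτ, hρτ, hτρ, hττ, ← rho_zero hρρ]
    congr 1
    have e : a' + b' + c' + c₀ = a + b + c := heq
    linear_combination (norm := abel1) e
  obtain ⟨h1, -, -⟩ := h _ (hX' a' ha') _ (hX a ha) _ (cond_mem_fst' (hY b hb) (hY b' hb'))
    _ (cond_mem_snd' (hY b hb) (hY b' hb')) _ (hZ c hc) _ (hZ' c' hc') key
  exact hne _ _ h1

end Shifted

section Exact

variable {A : Type*} [AddCommGroup A] [DecidableEq A]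

/-- Flipping a shifted disjointness (`2c₀ = 0`). [folklore] -/
theorem disjoint_image_add_comm {X Y : Finset A} {c₀ : A} (h2c : c₀ + c₀ = 0)
    (h : Disjoint X (Y.image (· + c₀))) : Disjoint (X.image (· + c₀)) Y := by
  rw [disjoint_left] at h ⊢
  intro y hy hyY
  obtain ⟨x, hx, rfl⟩ := mem_image.1 hy
  exact h hx (mem_image.2 ⟨x + c₀, hyY, by rw [add_assoc, h2c, add_zero]⟩)

variable [Fintype A]

/-- **Exact vertex ⇒ periodic box.** If `X ⊔ Y ⊔ Z = A` (pairwise disjoint, total size `|A|`) and `X + c₀` misses `Y`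
and `Z`, then `X` is `c₀`-periodic. [folklore] -/
theorem periodic_of_exact_vertex {X Y Z : Finset A} {c₀ : A} (hXY : Disjoint X Y) (hXZ : Disjoint X Z)
    (hYZ : Disjoint Y Z) (hcard : X.card + Y.card + Z.card = Fintype.card A)
    (h₁ : Disjoint (X.image (· + c₀)) Y) (h₂ : Disjoint (X.image (· + c₀)) Z) : X.image (· + c₀) = X := by
  have hcov : X ∪ Y ∪ Z = univ := by
    apply eq_univ_of_card
    rw [card_union_of_disjoint (disjoint_union_left.2 ⟨hXZ, hYZ⟩), card_union_of_disjoint hXY, hcard]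
  apply eq_of_subset_of_card_le _ (by rw [card_image_of_injective _ (add_left_injective c₀)])
  intro w hw
  have hu : w ∈ X ∪ Y ∪ Z := hcov ▸ mem_univ w
  rcases mem_union.1 hu with hu | hu
  · rcases mem_union.1 hu with hu | hu
    · exact hu
    · exact absurd hu (disjoint_left.1 h₁ hw)
  · exact absurd hu (disjoint_left.1 h₂ hw)

end Exact

section ThreeTerm

variable {A : Type*} [AddCommGroup A] [Fintype A]

/-- **No vanishing three-term character sums when `3 ∤ |A|`.**  If `ψ x + ψ y + ψ z = 0` for a character `ψ` then
`u = ψ(x − y)` satisfies `u² + u + 1 = 0`, hence `u³ = 1`; but `u^|A| = 1` and `3 ∤ |A|` give `u = 1`. [folklore] -/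
theorem three_term_charsum_ne_zero (h3 : ¬ 3 ∣ Fintype.card A) (ψ : AddChar A ℂ) (x y z : A) :
    ψ x + ψ y + ψ z ≠ 0 := by
  intro h
  -- conjugate relation
  have hc : ψ (-x) + ψ (-y) + ψ (-z) = 0 := by
    rw [AddChar.map_neg_eq_conj, AddChar.map_neg_eq_conj, AddChar.map_neg_eq_conj, ← map_add, ← map_add, h,
      map_zero]
  have m0 : ∀ a : A, ψ a * ψ (-a) = 1 := fun a => by
    rw [← AddChar.map_add_eq_mul, add_neg_cancel, AddChar.map_zero_eq_one]
  set u := ψ (x - y) with hu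
  set v := ψ (y - x) with hv
  have huv : u * v = 1 := by rw [hu, hv, ← AddChar.map_add_eq_mul, show x - y + (y - x) = 0 by abel,
    AddChar.map_zero_eq_one]
  have hu' : ψ x * ψ (-y) = u := by rw [hu, ← AddChar.map_add_eq_mul, sub_eq_add_neg]
  have hv' : ψ y * ψ (-x) = v := by rw [hv, ← AddChar.map_add_eq_mul, sub_eq_add_neg]
  -- `ψ z ψ(−z) = 1` with `ψ z = −(ψ x + ψ y)`, `ψ(−z) = −(ψ(−x) + ψ(−y))`
  have hz : ψ z = -(ψ x + ψ y) := by linear_combination h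
  have hz' : ψ (-z) = -(ψ (-x) + ψ (-y)) := by linear_combination hc
  have key : u + v = -1 := by
    have e := m0 z
    rw [hz, hz'] at e
    have ex := m0 x
    have ey := m0 y
    linear_combination e - ex - ey - hu' - hv'
  have hq : u ^ 2 + u + 1 = 0 := by linear_combination u * key - huv
  have hcube : u ^ 3 = 1 := by linear_combination (u - 1) * hq
  -- `u ^ |A| = 1`
  have hN : u ^ Fintype.card A = 1 := by
    rw [hu, ← AddChar.map_nsmul_eq_pow, card_nsmul_eq_zero, AddChar.map_zero_eq_one]
  -- `|A| = 3q + r`, `r ∈ {1, 2}`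
  obtain ⟨q, r, hr, hN'⟩ : ∃ q r, (r = 1 ∨ r = 2) ∧ Fintype.card A = 3 * q + r :=
    ⟨Fintype.card A / 3, Fintype.card A % 3, by omega, (Nat.div_add_mod _ 3).symm⟩
  rw [hN', pow_add, pow_mul, hcube, one_pow, one_mul] at hN
  rcases hr with rfl | rfl
  · rw [pow_one] at hN
    rw [hN] at hq
    norm_num at hq
  · have hu1 : u = 1 := by linear_combination hcube - u * hN
    rw [hu1] at hq
    norm_num at hq

end ThreeTerm

end Summit.MatrixMultiplication.OmegaCensus
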